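import Summits.AnomalousDissipation.AnomalousDissipation.Theses.EnsembleRigidity
import Summits.AnomalousDissipation.AnomalousDissipation.Theorems.EnsembleRigidityGPStatisticalRigidityPartial
import Summits.AnomalousDissipation.AnomalousDissipation.Theorems.EnsembleRigidityGPTameDefectFloorWeakDuality
import Summits.AnomalousDissipation.AnomalousDissipation.Theorems.EnsembleRigidityGPTameDefectFloorLinearFloor
import Summits.AnomalousDissipation.AnomalousDissipation.Theorems.EnsembleRigidityGPTameDefectFloorParityForm
import Summits.AnomalousDissipation.AnomalousDissipation.Theorems.EnsembleRigidityGPTameDefectFloorEnergyIdle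
import HarnessLib

/-!
# Tools stub `stub_gpTameRegionTools` of line `Sketch` (crux stmt-AnomalousDissipation-17938,
# `EnsembleRigidity.GPTameDefectFloor`) — THE PROVED REGION AND THE REDUCTION TO THE OPEN STUB

T = TAME DEFECT ∃ r : ℝ, 0 < r ∧ ∀ μ : Measure H3, IsProbabilityMeasure μ →
      Integrable (fun v : H3 => ‖v‖ ^ 2) μ → Torus.ensembleEnergy μ ≤ E →
      Torus.ensembleEnstrophy μ ≤ ENNReal.ofReal G₁ →
      ¬ (∀ Φ : Torus.CylindricalTest (Fin 3),
        Integrable (fun v : H3 => Torus.nsGeneratorPairing 0 f v (Φ.grad v)) μ ∧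
          |∫ v, Torus.nsGeneratorPairing 0 f v (Φ.grad v) ∂μ| ≤
            r * Real.sqrt (∫ v, Torus.gradNormSq (Φ.grad v) ∂μ)) OF `f_GP`: for every energy level `E` and mean-enstrophy level `G₁` there is
`r > 0` such that no probability measure `μ` on `H = L²_σ(T³)` with `∫|v|² dμ ≤ E` and
`∫‖∇v‖² dμ ≤ G₁` has Φ-uniform cylindrical forced-Euler defect `≤ r`.

This file composes the four landed stubs of the line:

* `gpTameFloor_smallEnstrophy` — T at EVERY level `(E, G₁)` with `G₁ < 3√2·π ≈ 13.33` (any `E`):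
  the linear floor (`stub_linearFloor`) fed with the parity enstrophy certificate `w = f_GP`
  (`stub_gpParityForm`: `∫ (v ⊗ v) : ∇f_GP ≥ −(√2/(4π)) ‖∇v‖²`), level condition
  `(√2/(4π)) max(G₁,0) < (f_GP, f_GP) = 3/2`. This extends the tree's region `G₁ < 3π`
  (`TameClosure.Negative.tameClosure_conclusion_false_smallEnstrophy`, Poincaré image of the energy
  horizon).
* `gpTameFloor_smallEnergy` — T at every level with `E < 3/(4π)` (any `G₁`): the same floor fed with
  the pointwise strain bound `∫ (v ⊗ v) : ∇f_GP ≥ −2π |v|²` (the landed energy horizon, here in the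
  crux's own `∃ r` form).
* `gpTameDefectFloor_of_certificatesHigh` — THE REDUCTION: if for every `G₁ ≥ 3√2·π` the force admits
  a cylindrical certificate of the Farkas-dual shape at the normalised level `(G₁/(4π²), G₁)` (the
  open stub `stub_tameCertificatesHigh`), then `EnsembleRigidity.GPTameDefectFloor` holds
  (`stub_tameWeakDuality` + `stub_energyIdle`).
* `stub_gpTameRegionTools` — the registered conjunction of the three.

## References

* C. Foias, O. Manley, R. Rosa, R. Temam, *Navier–Stokes Equations and Turbulence* (CUP 2001),
  Ch. IV §1.2 (stationary statistical solutions, (1.29)–(1.31)).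
* R. Rosa, R. Temam, arXiv:2010.06730 (auxiliary functionals / weak duality for statistical solutions).
* C. Doering, J. Gibbon, *Applied Analysis of the Navier–Stokes Equations* (CUP 1995), §2.2
  (energy-stability form `‖∇v‖² + ∫(v⊗v):∇U`).
-/

-- `Summit.<Summit>.<Problem>` is the tree's mandated summit-side namespace (CONVENTIONS §2); single-conjunct summit, duplicate deliberate.
set_option linter.dupNamespace false

noncomputable section

namespace Summit.AnomalousDissipation.AnomalousDissipation.Theorems.EnsembleRigidity.GPTameDefectFloor

open MeasureTheory Filter Topology UnitAddTorus
open scoped InnerProductSpace RealInnerProductSpace ENNReal NNReal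
open Literature.Analysis.FunctionSpaces Literature.Analysis.FluidPDE
open Summit.AnomalousDissipation.AnomalousDissipation.Theorems.EnsembleRigidity

/-- Local notation: real vector fields on `T³`. -/
local notation "Vec3" => (UnitAddTorus (Fin 3)) → (EuclideanSpace ℝ (Fin 3))
/-- Local notation: `L²(T³; ℝ³)`. -/
local notation "L2" => (Lp (EuclideanSpace ℝ (Fin 3)) 2 (volume : Measure (UnitAddTorus (Fin 3))))
/-- Local notation: the energy space `H`. -/
local notation "H3" => (Torus.energySpace (Fin 3))

/-! ## The two linear certificates carried by `w = f_GP` -/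

/-- The pointwise strain bound of `f_GP` as a form bound on `H`: `∫ (v ⊗ v) : ∇f_GP ≥ −2π |v|²`
(energy certificate, `s_E = 2π`, `s_G = 0`). [folklore] -/
theorem region_gpForce_energyForm (v : H3) (_hv : Torus.eGradNormSq ((v : L2) : Vec3) ≠ ⊤) :
    -(2 * Real.pi * ‖v‖ ^ 2 + 0 * (Torus.eGradNormSq ((v : L2) : Vec3)).toReal) ≤
      Torus.inertialPairing (v : L2) gpForce := by
  have h := GPStatisticalRigidity.gpForce_inertialPairing_ge (v : L2)
  rw [Submodule.coe_norm] at *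
  linarith

/-- The parity bound of `f_GP` as a form bound on `H` (enstrophy certificate, `s_E = 0`,
`s_G = √2/(4π)`). [folklore] -/
theorem region_gpForce_enstrophyForm (v : H3) (hv : Torus.eGradNormSq ((v : L2) : Vec3) ≠ ⊤) :
    -(0 * ‖v‖ ^ 2 + Real.sqrt 2 / (4 * Real.pi) * (Torus.eGradNormSq ((v : L2) : Vec3)).toReal) ≤
      Torus.inertialPairing (v : L2) gpForce := by
  have h := stub_gpParityForm v hv
  linarith

/-! ## The proved region -/

/-- **T below the parity enstrophy horizon.** For `f = f_GP` and every level `(E, G₁)` with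
`G₁ < 3√2·π` there is `r > 0` such that no probability measure on `H` with integrable energy `≤ E`
and mean enstrophy `≤ G₁` has Φ-uniform cylindrical forced-Euler defect `≤ r`. [folklore] -/
theorem gpTameFloor_smallEnstrophy (f : Vec3) (hf : f = gpForce) (E G₁ : ℝ)
    (hG : G₁ < 3 * Real.sqrt 2 * Real.pi) :
    ∃ r : ℝ, 0 < r ∧ ∀ μ : Measure H3, IsProbabilityMeasure μ →
      Integrable (fun v : H3 => ‖v‖ ^ 2) μ → Torus.ensembleEnergy μ ≤ E →
      Torus.ensembleEnstrophy μ ≤ ENNReal.ofReal G₁ →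
      ¬ (∀ Φ : Torus.CylindricalTest (Fin 3),
        Integrable (fun v : H3 => Torus.nsGeneratorPairing 0 f v (Φ.grad v)) μ ∧
          |∫ v, Torus.nsGeneratorPairing 0 f v (Φ.grad v) ∂μ| ≤
            r * Real.sqrt (∫ v, Torus.gradNormSq (Φ.grad v) ∂μ)) := by
  obtain ⟨hsm, hdf, hzm⟩ := GPStatisticalRigidity.gpForce_admissible
  have hff : ∫ x, ⟪f x, gpForce x⟫_ℝ = 3 / 2 := by
    rw [hf]
    exact GPStatisticalRigidity.gpForce_integral_inner_self
  have hpi : 0 < Real.pi := Real.pi_pos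
  refine stub_linearFloor f gpForce hf hsm hdf hzm 0 (Real.sqrt 2 / (4 * Real.pi)) le_rfl
    (by positivity) region_gpForce_enstrophyForm E G₁ ?_
  rw [hff, zero_mul, zero_add]
  have hs2 : Real.sqrt 2 * Real.sqrt 2 = 2 := Real.mul_self_sqrt zero_le_two
  have hs0 : 0 < Real.sqrt 2 := Real.sqrt_pos.2 zero_lt_two
  have hmax : max G₁ 0 < 3 * Real.sqrt 2 * Real.pi := max_lt hG (by positivity)
  rw [div_mul_eq_mul_div, div_lt_iff₀ (by positivity)]
  nlinarith [mul_lt_mul_of_pos_left hmax hs0]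

/-- **T below the energy horizon** (the landed second-moment horizon, in the crux's `∃ r` form). For
`f = f_GP` and every level `(E, G₁)` with `E < 3/(4π)` there is `r > 0` such that no probability
measure on `H` with integrable energy `≤ E` and mean enstrophy `≤ G₁` has Φ-uniform cylindrical
forced-Euler defect `≤ r`. [folklore] -/
theorem gpTameFloor_smallEnergy (f : Vec3) (hf : f = gpForce) (E G₁ : ℝ)
    (hE : E < 3 / (4 * Real.pi)) :
    ∃ r : ℝ, 0 < r ∧ ∀ μ : Measure H3, IsProbabilityMeasure μ →
      Integrable (fun v : H3 => ‖v‖ ^ 2) μ → Torus.ensembleEnergy μ ≤ E →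
      Torus.ensembleEnstrophy μ ≤ ENNReal.ofReal G₁ →
      ¬ (∀ Φ : Torus.CylindricalTest (Fin 3),
        Integrable (fun v : H3 => Torus.nsGeneratorPairing 0 f v (Φ.grad v)) μ ∧
          |∫ v, Torus.nsGeneratorPairing 0 f v (Φ.grad v) ∂μ| ≤
            r * Real.sqrt (∫ v, Torus.gradNormSq (Φ.grad v) ∂μ)) := by
  obtain ⟨hsm, hdf, hzm⟩ := GPStatisticalRigidity.gpForce_admissible
  have hff : ∫ x, ⟪f x, gpForce x⟫_ℝ = 3 / 2 := by
    rw [hf]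
    exact GPStatisticalRigidity.gpForce_integral_inner_self
  have hpi : 0 < Real.pi := Real.pi_pos
  refine stub_linearFloor f gpForce hf hsm hdf hzm (2 * Real.pi) 0 (by positivity) le_rfl
    region_gpForce_energyForm E G₁ ?_
  rw [hff, zero_mul, add_zero]
  rw [lt_div_iff₀ (by positivity)] at hE
  linarith

/-! ## The reduction -/

/-- **The reduction of line `Sketch`: cylindrical certificates above the linear layer ⇒ the crux.**
If for every `G₁ ≥ 3√2·π` the Galloway–Proctor force admits a cylindrical test functional `Ψ` and
constants `a`, `b ≥ 0`, `C > 0`, `Λ > 0` with `Λ⁻¹(1 + max G₁ 0) < a − b G₁/(4π²)`, cost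
`‖∇Ψ'(v)‖² ≤ C²(1 + ‖∇v‖²)` and `a − b|v|² − Λ⁻¹(1 + ‖∇v‖²) ≤ ⟨f_GP − B(v,v), Ψ'(v)⟩` on
finite-enstrophy `v ∈ H`, then `EnsembleRigidity.GPTameDefectFloor` holds: levels `G₁ < 3√2·π` by
`gpTameFloor_smallEnstrophy`, levels `G₁ ≥ 3√2·π` by the weak duality `stub_tameWeakDuality` at the
normalised level `(G₁/(4π²), G₁)` and the idle energy `stub_energyIdle`. [folklore] -/
theorem gpTameDefectFloor_of_certificatesHigh (hHigh : ∀ f : Vec3, f = (fun x : UnitAddTorus (Fin 3) =>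
      (Literature.Analysis.FluidPDE.Torus.stokesMode (Pi.single (2 : Fin 3) (1 : ℤ)) (EuclideanSpace.single (0 : Fin 3) (1 : ℝ)) false x +
        Literature.Analysis.FluidPDE.Torus.stokesMode (Pi.single (0 : Fin 3) (1 : ℤ)) (EuclideanSpace.single (1 : Fin 3) (1 : ℝ)) false x +
        Literature.Analysis.FluidPDE.Torus.stokesMode (Pi.single (1 : Fin 3) (1 : ℤ)) (EuclideanSpace.single (2 : Fin 3) (1 : ℝ)) false x :
        EuclideanSpace ℝ (Fin 3))) →
      ∀ G₁ : ℝ, 3 * Real.sqrt 2 * Real.pi ≤ G₁ →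
        ∃ (Ψ : Torus.CylindricalTest (Fin 3)) (a b C Λ : ℝ), 0 ≤ b ∧ 0 < C ∧ 0 < Λ ∧
          Λ⁻¹ * (1 + max G₁ 0) < a - b * (G₁ / (4 * Real.pi ^ 2)) ∧
          (∀ v : H3, Torus.gradNormSq (Ψ.grad v) ≤
            C ^ 2 * (1 + (Torus.eGradNormSq ((v : L2) : Vec3)).toReal)) ∧
          (∀ v : H3, Torus.eGradNormSq ((v : L2) : Vec3) ≠ ⊤ →
            a - b * ‖v‖ ^ 2 - Λ⁻¹ * (1 + (Torus.eGradNormSq ((v : L2) : Vec3)).toReal) ≤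
              Torus.nsGeneratorPairing 0 f v (Ψ.grad v))) :
    Summit.AnomalousDissipation.AnomalousDissipation.Theses.EnsembleRigidity.GPTameDefectFloor := by
  intro f hf E G₁
  have hf' : f = gpForce := hf.trans gpForce_eq.symm
  have hpi : 0 < Real.pi := Real.pi_pos
  by_cases hG : G₁ < 3 * Real.sqrt 2 * Real.pi
  · exact gpTameFloor_smallEnstrophy f hf' E G₁ hG
  · have hG' : 3 * Real.sqrt 2 * Real.pi ≤ G₁ := not_lt.1 hG
    have hG0 : 0 ≤ G₁ := le_trans (by positivity) hG'
    obtain ⟨Ψ, a, b, C, Λ, hb, hC, hΛ, hgap, hcost, hcert⟩ := hHigh f hf G₁ hG'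
    obtain ⟨r, hr, hfloor⟩ := stub_tameWeakDuality f (G₁ / (4 * Real.pi ^ 2)) G₁
      ⟨Ψ, a, b, C, Λ, hb, hC, hΛ, hgap, hcost, hcert⟩
    refine ⟨r, hr, stub_energyIdle f E G₁ r ?_⟩
    rw [max_eq_left hG0]
    exact hfloor

/-- **Tools stub `stub_gpTameRegionTools`** (registered on stmt-AnomalousDissipation-17938): the proved
region (`G₁ < 3√2·π`, any `E`; `E < 3/(4π)`, any `G₁`) and the reduction of the crux to cylindrical
certificates above the linear layer (line `Sketch`). [folklore] -/
theorem stub_gpTameRegionTools : (∀ f : Vec3, f = gpForce → ∀ E G₁ : ℝ, G₁ < 3 * Real.sqrt 2 * Real.pi → ∃ r : ℝ, 0 < r ∧ ∀ μ : Measure H3, IsProbabilityMeasure μ → Integrable (fun v : H3 => ‖v‖ ^ 2) μ → Torus.ensembleEnergy μ ≤ E → Torus.ensembleEnstrophy μ ≤ ENNReal.ofReal G₁ → ¬ (∀ Φ : Torus.CylindricalTest (Fin 3), Integrable (fun v : H3 => Torus.nsGeneratorPairing 0 f v (Φ.grad v)) μ ∧ |∫ v, Torus.nsGeneratorPairing 0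 f v (Φ.grad v) ∂μ| ≤ r * Real.sqrt (∫ v, Torus.gradNormSq (Φ.grad v) ∂μ))) ∧ (∀ f : Vec3, f = gpForce → ∀ E G₁ : ℝ, E < 3 / (4 * Real.pi) → ∃ r : ℝ, 0 < r ∧ ∀ μ : Measure H3, IsProbabilityMeasure μ → Integrable (fun v : H3 => ‖v‖ ^ 2) μ → Torus.ensembleEnergy μ ≤ E → Torus.ensembleEnstrophy μ ≤ ENNReal.ofReal G₁ → ¬ (∀ Φ : Torus.CylindricalTest (Fin 3), Integrable (fun v : H3 => Torus.nsGeneratorPairing 0 f v (Φ.grad v)) μ ∧ |∫ v, Torus.nsGeneratorPairing 0 f v (Φ.grad v) ∂μ| ≤ r * Real.sqrt (∫ v, Torus.gradNormSq (Φ.grad v) ∂μ))) ∧ ((∀ f : Vec3, f = (fun x : UnitAddTorus (Fin 3) => (Literature.Analysis.FluidPDE.Torus.stokesMode (Pi.single (2 : Fin 3) (1 : ℤ)) (EuclideanSpace.single (0 : Fin 3) (1 : ℝ)) false x + Literature.Analysis.FluidPDE.Torus.stokesMode (Pi.single (0 : Fin 3) (1 : ℤ)) (EuclideanSpace.single (1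 : Fin 3) (1 : ℝ)) false x + Literature.Analysis.FluidPDE.Torus.stokesMode (Pi.single (1 : Fin 3) (1 : ℤ)) (EuclideanSpace.single (2 : Fin 3) (1 : ℝ)) false x : EuclideanSpace ℝ (Fin 3))) → ∀ G₁ : ℝ, 3 * Real.sqrt 2 * Real.pi ≤ G₁ → ∃ (Ψ : Torus.CylindricalTest (Fin 3)) (a b C Λ : ℝ), 0 ≤ b ∧ 0 < C ∧ 0 < Λ ∧ Λ⁻¹ * (1 + max G₁ 0) < a - b * (G₁ / (4 * Real.pi ^ 2)) ∧ (∀ v : H3, Torus.gradNormSq (Ψ.grad v) ≤ C ^ 2 * (1 + (Torus.eGradNormSq ((v : L2) : Vec3)).toReal)) ∧ (∀ v : H3, Torus.eGradNormSq ((v : L2) : Vec3) ≠ ⊤ → a - b * ‖v‖ ^ 2 - Λ⁻¹ * (1 + (Torus.eGradNormSq ((v : L2) : Vec3)).toReal) ≤ Torus.nsGeneratorPairing 0 f v (Ψ.grad v))) → Summit.AnomalousDissipation.AnomalousDissipation.Theses.EnsembleRigidity.GPTameDefectFloor) :=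
  ⟨gpTameFloor_smallEnstrophy, gpTameFloor_smallEnergy, gpTameDefectFloor_of_certificatesHigh⟩

end Summit.AnomalousDissipation.AnomalousDissipation.Theorems.EnsembleRigidity.GPTameDefectFloor

end
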